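import Summits.Ventures.KdS.TileBasic
import HarnessLib

/-!
# Venture KdS — a GENERIC, corner-checked certificate for the horizon structure of `Δ_r` on a tile

HONEST FRAMING (venture `Summits/Ventures/KdS`, cell `pub-kds`): ELEMENTARY real analysis / bookkeeping, written so
that the "window constants" hypothesis (H4) of the box theorems can be discharged PER TILE by a finite list of
rational inequalities (`norm_num`). No claim about mode stability is made here.

THE CERTIFICATE. `HorizonCert` = six rationals `r0lo < r0hi < r1lo < r1hi < r2lo < r2hi`;
`HorizonCert.Valid c t` = at each of the four corners of the tile `t = [alo, ahi] × [Λlo, Λhi]`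
(`alo > 0`, `Λlo > 0`): `Δ(r0lo) > 0 > Δ(r0hi)`, `Δ(r1lo) < 0 < Δ(r1hi)`, `Δ(r2lo) > 0 > Δ(r2hi)`,
`Δ'(r0hi) < 0`, `Δ'(r1lo) > 0`, `Δ'(r1hi) > 0`, `Δ'(r2lo) < 0` (40 closed rational inequalities).
THEOREM `horizons_of_cert`: validity ⇒ for every `(a, Λ)` in the tile, `IsSubextremal 1 a Λ`, the
enclosures `rMinus ∈ (r0lo, r0hi)`, `rPlus ∈ (r1lo, r1hi)`, `rCosmo ∈ (r2lo, r2hi)`, `Δ_r > 0` on `[0, r₋)` and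
`Δ_r(r₋) = 0` (uniqueness/ordering of the three roots and the signs of `Δ_r` between/beyond them follow from the
concavity of `Δ_r'`: a function that decreases then increases is below the larger endpoint value, etc.).
-/

noncomputable section

open Set

namespace Summit.Ventures.KdS

open Literature.Geometry.Lorentzian Literature.Geometry.Lorentzian.KerrDeSitter

/-- Rational brackets for the three horizon radii. -/
structure HorizonCert where
  /-- bracket for `r₋` -/
  r0lo : ℝ
  /-- bracket for `r₋` -/
  r0hi : ℝ
  /-- bracket for `r₊` -/
  r1lo : ℝ
  /-- bracket for `r₊` -/
  r1hi : ℝ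
  /-- bracket for `r_c` -/
  r2lo : ℝ
  /-- bracket for `r_c` -/
  r2hi : ℝ

/-- Validity of a certificate on a tile: ordering, positivity of the tile, and the ten sign conditions
at the four corners (a finite conjunction of closed rational inequalities when all data are rational). -/
def HorizonCert.Valid (c : HorizonCert) (t : Tile) : Prop :=
  (0 < t.alo ∧ t.alo ≤ t.ahi ∧ 0 < t.Λlo ∧ t.Λlo ≤ t.Λhi) ∧
  (0 < c.r0lo ∧ c.r0lo < c.r0hi ∧ c.r0hi < c.r1lo ∧ c.r1lo < c.r1hi ∧ c.r1hi < c.r2lo ∧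
    c.r2lo < c.r2hi) ∧
  t.AtCorners (fun A L => 0 < dB c.r0lo A L) ∧ t.AtCorners (fun A L => dB c.r0hi A L < 0) ∧
  t.AtCorners (fun A L => dB c.r1lo A L < 0) ∧ t.AtCorners (fun A L => 0 < dB c.r1hi A L) ∧
  t.AtCorners (fun A L => 0 < dB c.r2lo A L) ∧ t.AtCorners (fun A L => dB c.r2hi A L < 0) ∧
  t.AtCorners (fun A L => dB1 c.r0hi A L < 0) ∧ t.AtCorners (fun A L => 0 < dB1 c.r1lo A L) ∧
  t.AtCorners (fun A L => 0 < dB1 c.r1hi A L) ∧ t.AtCorners (fun A L => dB1 c.r2lo A L < 0)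

section Cert

variable {c : HorizonCert} {t : Tile} (hv : c.Valid t) {a Λ : ℝ}
  (ha : t.alo ≤ a ∧ a ≤ t.ahi) (hΛ : t.Λlo ≤ Λ ∧ Λ ≤ t.Λhi)
include hv ha hΛ

omit hΛ in
/-- `a² ∈ [alo², ahi²]`. -/
private theorem sqA : t.alo ^ 2 ≤ a ^ 2 ∧ a ^ 2 ≤ t.ahi ^ 2 :=
  ⟨pow_le_pow_left₀ hv.1.1.le ha.1 2, pow_le_pow_left₀ (hv.1.1.le.trans ha.1) ha.2 2⟩

/-- From the corners to the tile: a bilinear quantity positive at the corners is positive. -/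
theorem pos_of_atCorners {α β γ δ : ℝ} (h : t.AtCorners fun A L => 0 < bil α β γ δ A L) :
    0 < bil α β γ δ (a ^ 2) Λ := by
  obtain ⟨h1, h2, h3, h4⟩ := h
  have hs := sqA hv ha
  refine lt_of_lt_of_le ?_ (bil_ge_min4 α β γ δ hs.1 hs.2 hΛ.1 hΛ.2)
  simp only [min4, lt_min_iff]; exact ⟨⟨h1, h2⟩, h3, h4⟩

/-- From the corners to the tile: a bilinear quantity negative at the corners is negative. -/
theorem neg_of_atCorners {α β γ δ : ℝ} (h : t.AtCorners fun A L => bil α β γ δ A L < 0) :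
    bil α β γ δ (a ^ 2) Λ < 0 := by
  obtain ⟨h1, h2, h3, h4⟩ := h
  have hs := sqA hv ha
  refine lt_of_le_of_lt (bil_le_max4 α β γ δ hs.1 hs.2 hΛ.1 hΛ.2) ?_
  simp only [max4, max_lt_iff]; exact ⟨⟨h1, h2⟩, h3, h4⟩

/-- A bilinear quantity is at most its corner maximum on the tile. -/
theorem le_cmax_bil (α β γ δ : ℝ) : bil α β γ δ (a ^ 2) Λ ≤ t.cmax (bil α β γ δ) := by
  have hs := sqA hv ha
  exact bil_le_max4 α β γ δ hs.1 hs.2 hΛ.1 hΛ.2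

/-- A bilinear quantity is at least its corner minimum on the tile. -/
theorem cmin_le_bil (α β γ δ : ℝ) : t.cmin (bil α β γ δ) ≤ bil α β γ δ (a ^ 2) Λ := by
  have hs := sqA hv ha
  exact bil_ge_min4 α β γ δ hs.1 hs.2 hΛ.1 hΛ.2

/-- The ten sign conditions at the actual parameters. -/
theorem signs_of_cert :
    0 < delta 1 a Λ c.r0lo ∧ delta 1 a Λ c.r0hi < 0 ∧ delta 1 a Λ c.r1lo < 0 ∧
      0 < delta 1 a Λ c.r1hi ∧ 0 < delta 1 a Λ c.r2lo ∧ delta 1 a Λ c.r2hi < 0 ∧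
      deltaDeriv 1 a Λ c.r0hi < 0 ∧ 0 < deltaDeriv 1 a Λ c.r1lo ∧ 0 < deltaDeriv 1 a Λ c.r1hi ∧
      deltaDeriv 1 a Λ c.r2lo < 0 := by
  have hvc := hv
  obtain ⟨-, -, s1, s2, s3, s4, s5, s6, d1, d2, d3, d4⟩ := hvc
  simp only [delta_eq_dB, deltaDeriv_eq_dB1, dB, dB1] at s1 s2 s3 s4 s5 s6 d1 d2 d3 d4 ⊢
  exact ⟨pos_of_atCorners hv ha hΛ s1, neg_of_atCorners hv ha hΛ s2, neg_of_atCorners hv ha hΛ s3,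
    pos_of_atCorners hv ha hΛ s4, pos_of_atCorners hv ha hΛ s5, neg_of_atCorners hv ha hΛ s6,
    neg_of_atCorners hv ha hΛ d1, pos_of_atCorners hv ha hΛ d2, pos_of_atCorners hv ha hΛ d3,
    neg_of_atCorners hv ha hΛ d4⟩

/-- `Δ_r' < 0` on `[0, r0hi]`, `> 0` on `[r1lo, r1hi]`, `< 0` on `[r2lo, ∞)`. -/
theorem deltaDeriv_signs_of_cert :
    (∀ r, 0 ≤ r → r ≤ c.r0hi → deltaDeriv 1 a Λ r < 0) ∧
      (∀ r, c.r1lo ≤ r → r ≤ c.r1hi → 0 < deltaDeriv 1 a Λ r) ∧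
      (∀ r, c.r2lo ≤ r → deltaDeriv 1 a Λ r < 0) := by
  obtain ⟨-, -, -, -, -, -, d1, d2, d3, d4⟩ := signs_of_cert hv ha hΛ
  have hvc := hv
  obtain ⟨⟨-, -, hL0, -⟩, ⟨h0, h00, h01, h11, h12, h22⟩, -⟩ := hvc
  have hΛ0 : 0 ≤ Λ := by linarith [hΛ.1]
  refine ⟨fun r hr0 hr1 => ?_, fun r hr0 hr1 => ?_, fun r hr0 => ?_⟩
  · exact lt_of_le_of_lt (deltaDeriv_le_before hΛ0 hr0 hr1 (by linarith) d1 d2) d1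
  · exact lt_of_lt_of_le (lt_min d2 d3) (deltaDeriv_ge_min_between hΛ0 (by linarith) hr0 hr1)
  · exact lt_of_le_of_lt (deltaDeriv_le_after hΛ0 (by linarith) (by linarith) hr0 d3 d4) d4

/-- Monotonicity of `Δ_r` on the three bracket regions. -/
theorem delta_mono_of_cert :
    StrictAntiOn (fun r => delta 1 a Λ r) (Icc 0 c.r0hi) ∧
      StrictMonoOn (fun r => delta 1 a Λ r) (Icc c.r1lo c.r1hi) ∧
      StrictAntiOn (fun r => delta 1 a Λ r) (Ici c.r2lo) := by
  obtain ⟨e1, e2, e3⟩ := deltaDeriv_signs_of_cert hv ha hΛ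
  refine ⟨?_, ?_, ?_⟩
  · refine strictAntiOn_of_deriv_neg (convex_Icc _ _) (continuous_delta 1 a Λ).continuousOn ?_
    intro x hx; rw [interior_Icc] at hx; rw [deriv_delta]; exact e1 x hx.1.le hx.2.le
  · refine strictMonoOn_of_deriv_pos (convex_Icc _ _) (continuous_delta 1 a Λ).continuousOn ?_
    intro x hx; rw [interior_Icc] at hx; rw [deriv_delta]; exact e2 x hx.1.le hx.2.le
  · refine strictAntiOn_of_deriv_neg (convex_Ici _) (continuous_delta 1 a Λ).continuousOn ?_
    intro x hx; rw [interior_Ici] at hx; rw [deriv_delta]; exact e3 x hx.le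

/-- `Δ_r < 0` on `[r0hi, r1lo]` and `Δ_r > 0` on `[r1hi, r2lo]` (the gaps between the brackets):
a function that decreases then increases is below the larger endpoint value, etc. -/
theorem delta_gap_signs_of_cert :
    (∀ r, c.r0hi ≤ r → r ≤ c.r1lo → delta 1 a Λ r < 0) ∧
      (∀ r, c.r1hi ≤ r → r ≤ c.r2lo → 0 < delta 1 a Λ r) := by
  obtain ⟨-, s0hi, s1lo, s1hi, s2lo, -, d1, d2, d3, d4⟩ := signs_of_cert hv ha hΛ
  have hvc := hv
  obtain ⟨⟨-, -, hL0, -⟩, ⟨h0, h00, h01, h11, h12, h22⟩, -⟩ := hvc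
  have hΛ0 : 0 ≤ Λ := by linarith [hΛ.1]
  have hcont : ∀ s : Set ℝ, ContinuousOn (fun x => delta 1 a Λ x) s :=
    fun s => (continuous_delta 1 a Λ).continuousOn
  refine ⟨fun r hr0 hr1 => ?_, fun r hr0 hr1 => ?_⟩
  · rcases le_or_gt (deltaDeriv 1 a Λ r) 0 with hle | hgt
    · -- `Δ' ≤ 0` on `[r0hi, r]`: antitone there
      have hanti : AntitoneOn (fun x => delta 1 a Λ x) (Icc c.r0hi r) := by
        refine antitoneOn_of_deriv_nonpos (convex_Icc _ _) (hcont _) ?_ ?_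
        · exact fun x _ => (hasDerivAt_delta 1 a Λ x).differentiableAt.differentiableWithinAt
        · intro w hw; rw [interior_Icc] at hw; rw [deriv_delta]
          by_contra hpos; rw [not_le] at hpos
          have := deltaDeriv_ge_min_between (M := 1) (a := a) hΛ0 (by linarith [hw.1]) hw.2.le hr1
          have : 0 < deltaDeriv 1 a Λ r := lt_of_lt_of_le (lt_min hpos d2) this
          linarith
      have := hanti ⟨le_rfl, hr0⟩ ⟨hr0, le_rfl⟩ hr0
      exact lt_of_le_of_lt this s0hi
    · -- `Δ' > 0` on `[r, r1lo]`: monotone there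
      have hmono : MonotoneOn (fun x => delta 1 a Λ x) (Icc r c.r1lo) := by
        refine monotoneOn_of_deriv_nonneg (convex_Icc _ _) (hcont _) ?_ ?_
        · exact fun x _ => (hasDerivAt_delta 1 a Λ x).differentiableAt.differentiableWithinAt
        · intro w hw; rw [interior_Icc] at hw; rw [deriv_delta]
          exact (lt_of_lt_of_le (lt_min hgt d2) (deltaDeriv_ge_min_between (M := 1) (a := a) hΛ0
            (by linarith [hw.1]) hw.1.le hw.2.le)).le
      have := hmono ⟨le_rfl, hr1⟩ ⟨hr1, le_rfl⟩ hr1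
      exact lt_of_le_of_lt this s1lo
  · rcases lt_or_ge (deltaDeriv 1 a Λ r) 0 with hlt | hge
    · -- `Δ' < 0` on `[r, ∞)`: antitone on `[r, r2lo]`
      have hr0' : c.r1hi < r := lt_of_le_of_ne hr0 (fun h => by rw [← h] at hlt; linarith)
      have hanti : AntitoneOn (fun x => delta 1 a Λ x) (Icc r c.r2lo) := by
        refine antitoneOn_of_deriv_nonpos (convex_Icc _ _) (hcont _) ?_ ?_
        · exact fun x _ => (hasDerivAt_delta 1 a Λ x).differentiableAt.differentiableWithinAt
        · intro w hw; rw [interior_Icc] at hw; rw [deriv_delta]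
          exact ((deltaDeriv_le_after (M := 1) (a := a) hΛ0 (by linarith) hr0'
            hw.1.le d3 hlt).trans hlt.le)
      have := hanti ⟨le_rfl, hr1⟩ ⟨hr1, le_rfl⟩ hr1
      exact lt_of_lt_of_le s2lo this
    · -- `Δ' ≥ 0` on `[r1hi, r]`: monotone there
      have hmono : MonotoneOn (fun x => delta 1 a Λ x) (Icc c.r1hi r) := by
        refine monotoneOn_of_deriv_nonneg (convex_Icc _ _) (hcont _) ?_ ?_
        · exact fun x _ => (hasDerivAt_delta 1 a Λ x).differentiableAt.differentiableWithinAt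
        · intro w hw; rw [interior_Icc] at hw; rw [deriv_delta]
          by_contra hneg; rw [not_le] at hneg
          have := deltaDeriv_le_after (M := 1) (a := a) hΛ0 (by linarith) hw.1 hw.2.le d3 hneg
          linarith
      have := hmono ⟨le_rfl, hr0⟩ ⟨hr0, le_rfl⟩ hr0
      exact lt_of_lt_of_le s1hi this

/-- The three zeros with their enclosures and the full sign pattern of `Δ_r` on `[0, ∞)`. -/
theorem exists_horizons_of_cert :
    ∃ r₀ r₁ r₂ : ℝ, r₀ ∈ Ioo c.r0lo c.r0hi ∧ r₁ ∈ Ioo c.r1lo c.r1hi ∧ r₂ ∈ Ioo c.r2lo c.r2hi ∧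
      delta 1 a Λ r₀ = 0 ∧ delta 1 a Λ r₁ = 0 ∧ delta 1 a Λ r₂ = 0 ∧
      (∀ r, 0 ≤ r → r < r₀ → 0 < delta 1 a Λ r) ∧
      (∀ r, r₀ < r → r < r₁ → delta 1 a Λ r < 0) ∧
      (∀ r, r₁ < r → r < r₂ → 0 < delta 1 a Λ r) ∧
      (∀ r, r₂ < r → delta 1 a Λ r < 0) := by
  obtain ⟨s0lo, s0hi, s1lo, s1hi, s2lo, s2hi, -, -, -, -⟩ := signs_of_cert hv ha hΛ
  obtain ⟨hlow, hmid, hhigh⟩ := delta_mono_of_cert hv ha hΛ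
  obtain ⟨gap1, gap2⟩ := delta_gap_signs_of_cert hv ha hΛ
  have hvc := hv
  obtain ⟨-, ⟨h0, h00, h01, h11, h12, h22⟩, -⟩ := hvc
  have hcont := continuous_delta 1 a Λ
  obtain ⟨r₀, hr₀, hz₀⟩ : ∃ r ∈ Icc c.r0lo c.r0hi, delta 1 a Λ r = 0 :=
    intermediate_value_Icc' h00.le hcont.continuousOn ⟨s0hi.le, s0lo.le⟩
  obtain ⟨r₁, hr₁, hz₁⟩ : ∃ r ∈ Icc c.r1lo c.r1hi, delta 1 a Λ r = 0 :=
    intermediate_value_Icc h11.le hcont.continuousOn ⟨s1lo.le, s1hi.le⟩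
  obtain ⟨r₂, hr₂, hz₂⟩ : ∃ r ∈ Icc c.r2lo c.r2hi, delta 1 a Λ r = 0 :=
    intermediate_value_Icc' h22.le hcont.continuousOn ⟨s2hi.le, s2lo.le⟩
  have hr₀' : r₀ ∈ Ioo c.r0lo c.r0hi := by
    refine ⟨lt_of_le_of_ne hr₀.1 ?_, lt_of_le_of_ne hr₀.2 ?_⟩
    · rintro h; rw [← h] at hz₀; linarith
    · rintro h; rw [h] at hz₀; linarith
  have hr₁' : r₁ ∈ Ioo c.r1lo c.r1hi := by
    refine ⟨lt_of_le_of_ne hr₁.1 ?_, lt_of_le_of_ne hr₁.2 ?_⟩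
    · rintro h; rw [← h] at hz₁; linarith
    · rintro h; rw [h] at hz₁; linarith
  have hr₂' : r₂ ∈ Ioo c.r2lo c.r2hi := by
    refine ⟨lt_of_le_of_ne hr₂.1 ?_, lt_of_le_of_ne hr₂.2 ?_⟩
    · rintro h; rw [← h] at hz₂; linarith
    · rintro h; rw [h] at hz₂; linarith
  refine ⟨r₀, r₁, r₂, hr₀', hr₁', hr₂', hz₀, hz₁, hz₂, ?_, ?_, ?_, ?_⟩
  · intro r hr0 hr1
    have := hlow ⟨hr0, by linarith [hr₀'.2]⟩ ⟨by linarith [hr₀'.1], hr₀.2⟩ hr1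
    simpa [hz₀] using this
  · intro r hr0 hr1
    rcases le_or_gt r c.r0hi with hle | hgt
    · have := hlow ⟨by linarith [hr₀'.1], hr₀.2⟩ ⟨by linarith [hr₀'.1], hle⟩ hr0
      simpa [hz₀] using this
    rcases lt_or_ge r c.r1lo with hlt' | hge'
    · exact gap1 r hgt.le hlt'.le
    · have := hmid ⟨hge', by linarith [hr₁'.2]⟩ ⟨hr₁.1, hr₁.2⟩ hr1
      simpa [hz₁] using this
  · intro r hr0 hr1
    rcases le_or_gt r c.r1hi with hle | hgt
    · have := hmid ⟨hr₁.1, hr₁.2⟩ ⟨by linarith [hr₁'.1], hle⟩ hr0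
      simpa [hz₁] using this
    rcases lt_or_ge r c.r2lo with hlt' | hge'
    · exact gap2 r hgt.le hlt'.le
    · have := hhigh (show c.r2lo ≤ r from hge') (show c.r2lo ≤ r₂ from hr₂.1) hr1
      simpa [hz₂] using this
  · intro r hr0
    have := hhigh (show c.r2lo ≤ r₂ from hr₂.1) (show c.r2lo ≤ r by linarith [hr₂.1]) hr0
    simpa [hz₂] using this

/-- **Generic H4, part 1.** A valid certificate gives `IsSubextremal 1 a Λ` and the three enclosures
on the whole tile, plus `Δ_r > 0` on `[0, r₋)`. -/
theorem horizons_of_cert :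
    IsSubextremal 1 a Λ ∧ rMinus 1 a Λ ∈ Ioo c.r0lo c.r0hi ∧ rPlus 1 a Λ ∈ Ioo c.r1lo c.r1hi ∧
      rCosmo 1 a Λ ∈ Ioo c.r2lo c.r2hi ∧ (∀ r, 0 ≤ r → r < rMinus 1 a Λ → 0 < delta 1 a Λ r) ∧
      delta 1 a Λ (rMinus 1 a Λ) = 0 := by
  obtain ⟨r₀, r₁, r₂, hr₀, hr₁, hr₂, hz₀, hz₁, hz₂, hA, hB, hC, hD⟩ :=
    exists_horizons_of_cert hv ha hΛ
  have hvc := hv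
  obtain ⟨⟨-, -, hL0, -⟩, ⟨h0, h00, h01, h11, h12, h22⟩, -⟩ := hvc
  have h01' : r₀ < r₁ := by linarith [hr₀.2, hr₁.1]
  have h12' : r₁ < r₂ := by linarith [hr₁.2, hr₂.1]
  -- rCosmo = r₂
  have hc : rCosmo 1 a Λ = r₂ := by
    unfold rCosmo
    refine IsLUB.csSup_eq ⟨?_, ?_⟩ ⟨(r₁ + r₂) / 2, ?_⟩
    · intro r (hr : 0 < delta 1 a Λ r)
      by_contra h
      exact absurd hr (not_lt.mpr (hD r (not_le.mp h)).le)
    · intro b hb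
      by_contra h
      rw [not_le] at h
      set r := (max b r₁ + r₂) / 2 with hr_def
      have hm := max_lt h h12'
      have hr1 : max b r₁ < r := by rw [hr_def]; linarith
      have hr2 : r < r₂ := by rw [hr_def]; linarith
      have hpos : 0 < delta 1 a Λ r := hC r (lt_of_le_of_lt (le_max_right b r₁) hr1) hr2
      have := hb hpos
      linarith [le_max_left b r₁]
    · show 0 < delta 1 a Λ ((r₁ + r₂) / 2)
      exact hC _ (by linarith) (by linarith)
  -- rPlus = r₁
  have hp : rPlus 1 a Λ = r₁ := by
    unfold rPlus
    rw [hc]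
    refine IsGreatest.csSup_eq ⟨⟨h12', hz₁.le⟩, ?_⟩
    intro r ⟨hrlt, hrle⟩
    by_contra h
    exact absurd hrle (not_le.mpr (hC r (not_le.mp h) hrlt))
  -- rMinus = r₀
  have hm : rMinus 1 a Λ = r₀ := by
    unfold rMinus
    refine IsLeast.csInf_eq ⟨⟨by linarith [hr₀.1], hz₀.le⟩, ?_⟩
    intro r ⟨hr0, hrle⟩
    by_contra h
    exact absurd hrle (not_le.mpr (hA r hr0.le (not_le.mp h)))
  refine ⟨⟨one_pos, by linarith [hΛ.1], ?_, ?_, ?_, ?_, ?_, ?_, ?_⟩, ?_, ?_, ?_, ?_, ?_⟩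
  · rw [hm, hp]; exact h01'
  · rw [hp, hc]; exact h12'
  · rw [hp]; exact hz₁
  · rw [hc]; exact hz₂
  · intro r hr; rw [hm, hp] at hr; exact hB r hr.1 hr.2
  · intro r hr; rw [hp, hc] at hr; exact hC r hr.1 hr.2
  · intro r hr; rw [hc] at hr; exact hD r hr
  · rw [hm]; exact hr₀
  · rw [hp]; exact hr₁
  · rw [hc]; exact hr₂
  · intro r hr0 hr1; rw [hm] at hr1; exact hA r hr0 hr1
  · rw [hm]; exact hz₀

end Cert

end Summit.Ventures.KdS

end
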